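import Literature.Analysis.FluidPDE.NSConvectiveStokesForm
import Literature.Analysis.FluidPDE.NSBoundedSuitableEnergy
import Literature.Analysis.FluidPDE.CKNLocalEnergyBound
import Literature.Analysis.FluidPDE.SereginLocalStokesIntegrabilityGain
import HarnessLib

/-!
# Seregin–Šverák 2009, §4: the uniform local Hölder bound, assembled from the linear theory

Analysis/FluidPDE proof file for the named fact
`Literature.Analysis.FluidPDE.SereginSverak2009.LocalHolderBound`
(`FluidPDE/SereginSverakBlowup`; Seregin–Šverák 2009, *On Type I singularities of the local
axi-symmetric solutions of the Navier–Stokes equations*, Comm. PDE 34 (2009) = arXiv:0804.1803,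
§4 p. 11 = Seregin 2014, §6.5 p. 125: the blow-up sequence of bounded solutions with `L_{3/2}`
pressure "is uniformly bounded in the parabolic Hölder space `C^{1/2}(Q̄(a/2))`").

`SereginSverak2009.localHolderBound_of` **proves** `LocalHolderBound` from the two named facts
of the local regularity theory of the Stokes system, Seregin 2014 Prop. 6.7 (`s = m`),
`StokesLocalW21Estimate` (`FluidPDE/SereginLocalStokesW21`), and `StokesLocalHolderBound`
(`FluidPDE/SereginLocalStokesRegularity`), along the printed chain and with every constant uniform
in the data:

1. restriction from the Seregin–Šverák cylinder `𝒞(4a) × ]-16a², 0[` to the ball cylinder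
   `Q(4a) = ]-16a², 0[ × B(0, 4a)` (`parabolicCylinder_origin_subset_parCyl`);
2. "`‖∇u‖_{3/2,Q(3a)} ≤ c₂(a)`" — the gradient bound. The paper obtains it from the heat equation
   `∂ₜu - Δu = -div F`, `F = u ⊗ u + p 𝕀 ∈ L_{3/2}` "see [LSU]" (the `L_{3/2}` theory of the heat
   equation with divergence-form right-hand side, a parabolic Calderón–Zygmund estimate that
   neither Mathlib nor the tree has). Here it is PROVED instead through the energy class, as the
   same paper notes on p. 6 (§2, (b8)–(b10): a bounded distributional solution with `L_{3/2}`
   pressure "is in fact a suitable weak solution"): by the tree's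
   `isSuitableWeakSolutionOn_of_bounded` (`FluidPDE/NSBoundedSuitableEnergy`) the pair is a
   suitable weak solution on `Q(4a)` with a weak spatial gradient `∇u = G ∈ L²_loc`, and the
   tree's absolute local energy bound `localEnergyBound` (`FluidPDE/CKNLocalEnergyBound`,
   Caffarelli–Kohn–Nirenberg's `A(R/2) + E(R/2) ≤ c (C(R)^{2/3} + C(R) + D(R)^{2/3} C(R)^{1/3})`,
   applied on small cylinders whose closures lie in `Q(4a)`, and exhausted up to the top time)
   gives, since `C ≤ ρ⁻² |Q(4a)|` (`|u| ≤ 1`), `D ≤ ρ⁻² c` and `F = 0` on each of them,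
   `∫∫_{Q(3a)} |∇u|² ≤ Y(a, c)`; Hölder's inequality on the bounded cylinder then bounds
   `‖∇u‖_{3/2,Q(3a)}` (`exists_weakGradient_bound_of_bounded`, stated for an arbitrary centre and
   radii `0 < r < R`: finitely many small cylinders `Q(ζ, ρ)`, `ρ = (R - r)/4`, whose doubles have
   closure in `Q(z₀, R)`, cover `Q(z₀, r)` below each time level, with a number independent of
   the level — a compactness cover of the body and a `ρ`-net of the ball for the top layer);
3. "we can interpret the pair `u` and `p` as a solution to the nonhomogeneous Stokes system (p12)
   … where `f = -u·∇u`", `‖f‖_{3/2} ≤ ‖∇u‖_{3/2}` — PROVED: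
   `isDistributionalStokesSolutionOn_of_isDistributionalNSSolutionOn`
   (`FluidPDE/NSConvectiveStokesForm`, resting on the weak product rule of
   `FluidPDE/NSWeakProductRule`) and `mixedNorm_force_le` (`|f| ≤ |∇u|` as `|u| ≤ 1`);
4. two rounds of "the local regularity theory for the Stokes system [S8] … together with the
   embedding theorem" — Seregin 2014, Prop. 6.7 (`s = m`), the named fact `StokesLocalW21Estimate`,
   combined with the Sobolev imbedding on balls (PROVED: `stokesLocalIntegrabilityGain_of_W21`,
   `FluidPDE/SereginLocalStokesIntegrabilityGain`), with `(m, q, n) = (3/2, 3, 3/2)` on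
   `Q(3a) → Q(2a)` and `(3, 6, 3/2)` on `Q(2a) → Q(3a/2)`;
5. "The local regularity theory leads then to the estimate … By the embedding theorem, sequence
   `u^k` is uniformly bounded in the parabolic Hölder space" — the named fact
   `StokesLocalHolderBound` with `(s, n) = (6, 3/2)`, `μ = 2 - 2/n - 3/s = 1/6`, on
   `Q(3a/2) → Q(a)`;
6. restriction to `Q(a/2) = 𝒞(a/2) × ]-a²/4, 0[ ⊆ Q(a)` (`parCyl_half_subset_parabolicCylinder`) and
   conversion of the parabolic modulus into Mathlib's `HolderOnWith` for the max product metric,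
   exponent `μ/2 = 1/12` (`holderOnWith_of_parabolic`).

The trust base of `LocalHolderBound` is thereby exactly
`StokesLocalW21Estimate ∧ StokesLocalHolderBound` (Seregin 2014, Props. 6.7–6.8; the second fact is
itself reduced to `StokesLocalW21Estimate ∧ ParabolicSobolevHolderEmbedding` by the proved
`StokesLocalHolderBound_of` of `FluidPDE/SereginLocalStokesW21`); the unconditional
`LocalHolderBound_holds` is the one-liner
`localHolderBound_of StokesLocalW21Estimate_holds StokesLocalHolderBound_holds` once those facts are
discharged (to be appended here). The heat-equation fact `HeatDivSourceGradientBound` of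
`FluidPDE/SereginLocalStokesRegularity` is no longer used by this file, and the composite
"Prop. 6.7 + Sobolev imbedding", at first a named fact `StokesLocalIntegrabilityGain` of its own, not
being a distinct printed result, was merged back into this assembly (D-0026).

## References

* G. Seregin, V. Šverák, Comm. PDE 34 (2009) = arXiv:0804.1803, §4 p. 11, (p12) and the displayed
  estimates following it. [`SereginSverak2009`]
* G. Seregin, *Lecture notes on regularity theory for the Navier–Stokes equations* (2014), §4.6
  Props. 6.7–6.8, §6.5 p. 125. [`Seregin2014`]
* O. A. Ladyzhenskaya, V. A. Solonnikov, N. N. Ural'tseva, *Linear and quasi-linear equations of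
  parabolic type* (1968). [`LadyzhenskayaSolonnikovUraltseva1968`]
* L. Caffarelli, R. Kohn, L. Nirenberg, *Partial regularity of suitable weak solutions of the
  Navier–Stokes equations*, Comm. Pure Appl. Math. 35 (1982), §2 (2.5) and Lemma 5.1.
  [`CaffarelliKohnNirenberg1982`]
-/

noncomputable section

open MeasureTheory TopologicalSpace Set Function Metric Filter
open scoped Laplacian InnerProductSpace RealInnerProductSpace ENNReal NNReal Topology

namespace Literature.Analysis.FluidPDE

namespace SereginSverak2009

/-- Local notation for physical space `ℝ³ = EuclideanSpace ℝ (Fin 3)`. -/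
local notation "ℝ³" => EuclideanSpace ℝ (Fin 3)

/-! ### Bookkeeping lemmas -/

/-- `‖x‖ ≤ 1` gives `‖x‖ₑ ≤ 1`. [folklore] -/
private theorem enorm_le_one {x : ℝ³} (h : ‖x‖ ≤ 1) : ‖x‖ₑ ≤ 1 := by
  rw [← ofReal_norm]
  exact ENNReal.ofReal_le_one.2 h

/-- The force `f = -(∇u) u` is dominated by `∇u` when `|u| ≤ 1`: `‖f‖_{s,n} ≤ ‖∇u‖_{s,n}`.
[folklore] -/
theorem mixedNorm_force_le {s n : ℝ} (hs : 0 ≤ s) (hn : 0 < n) {z : ℝ × ℝ³} {R : ℝ}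
    {u : ℝ → ℝ³ → ℝ³} {G : ℝ → ℝ³ → ℝ³ →L[ℝ] ℝ³}
    (hbd : ∀ᵐ w ∂(volume.restrict (parabolicCylinder R z)), ‖u w.1 w.2‖ ≤ 1) :
    mixedNorm s n z R (uncurry fun t x => -(G t x (u t x))) ≤ mixedNorm s n z R (uncurry G) := by
  refine mixedNorm_mono_ae hs hn ?_
  filter_upwards [hbd] with w hw
  rw [← ofReal_norm, ← ofReal_norm]
  refine ENNReal.ofReal_le_ofReal ?_
  simp only [uncurry, norm_neg]
  calc ‖G w.1 w.2 (u w.1 w.2)‖ ≤ ‖G w.1 w.2‖ * ‖u w.1 w.2‖ := ContinuousLinearMap.le_opNorm _ _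
    _ ≤ ‖G w.1 w.2‖ * 1 := by gcongr
    _ = ‖G w.1 w.2‖ := mul_one _

/-- The `L_{3/2}` mixed norm of the pressure on a ball cylinder inside `Q(4a)` is controlled by the
hypothesis `∫∫_{Q(4a)} |p|^{3/2} ≤ c`. [folklore] -/
theorem mixedNorm_pressure_le {a : ℝ} {c : ℝ≥0} {R : ℝ} {p : ℝ → ℝ³ → ℝ}
    (hsub : parabolicCylinder R ((0 : ℝ), (0 : ℝ³)) ⊆ parCyl 0 (4 * a))
    (hpm : AEStronglyMeasurable (uncurry p)
      (volume.restrict (parabolicCylinder R ((0 : ℝ), (0 : ℝ³)))))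
    (hp : ∫⁻ w in parCyl 0 (4 * a), ‖p w.1 w.2‖ₑ ^ (3 / 2 : ℝ) ≤ c) :
    mixedNorm (3 / 2) (3 / 2) ((0 : ℝ), (0 : ℝ³)) R (uncurry p) ≤
      (c : ℝ≥0∞) ^ (1 / (3 / 2 : ℝ)) := by
  rw [mixedNorm_self_eq (by norm_num) _ R hpm.enorm]
  exact ENNReal.rpow_le_rpow ((lintegral_mono_set hsub).trans hp) (by norm_num)

/-- The `L_{3/2}` mixed norm of `F = u ⊗ u + p 𝕀` on `Q(4a)` for `|u| ≤ 1`: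
`‖F‖_{3/2} ≤ (2^{1/2} (|Q(4a)| + c))^{2/3}`. [folklore] -/
theorem mixedNorm_ssTensor_le {a : ℝ} {c : ℝ≥0} {u : ℝ → ℝ³ → ℝ³} {p : ℝ → ℝ³ → ℝ}
    (hbd : ∀ᵐ w ∂(volume.restrict (parabolicCylinder (4 * a) ((0 : ℝ), (0 : ℝ³)))),
      ‖u w.1 w.2‖ ≤ 1)
    (hpm : AEStronglyMeasurable (uncurry p)
      (volume.restrict (parabolicCylinder (4 * a) ((0 : ℝ), (0 : ℝ³)))))
    (hp : ∫⁻ w in parabolicCylinder (4 * a) ((0 : ℝ), (0 : ℝ³)), ‖p w.1 w.2‖ₑ ^ (3 / 2 : ℝ) ≤ c) :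
    mixedNorm (3 / 2) (3 / 2) ((0 : ℝ), (0 : ℝ³)) (4 * a)
        (uncurry fun t x => ssTensor (u t x) (p t x)) ≤
      ((2 : ℝ≥0∞) ^ ((3 : ℝ) / 2 - 1) *
        (volume (parabolicCylinder (4 * a) ((0 : ℝ), (0 : ℝ³))) + c)) ^ (1 / (3 / 2 : ℝ)) := by
  set Q : Set (ℝ × ℝ³) := parabolicCylinder (4 * a) ((0 : ℝ), (0 : ℝ³)) with hQ
  -- compare with the scalar majorant `1 + |p|`
  have h1 : mixedNorm (3 / 2) (3 / 2) ((0 : ℝ), (0 : ℝ³)) (4 * a)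
      (uncurry fun t x => ssTensor (u t x) (p t x)) ≤
      mixedNorm (3 / 2) (3 / 2) ((0 : ℝ), (0 : ℝ³)) (4 * a)
        (fun w : ℝ × ℝ³ => (1 : ℝ≥0∞) + ‖p w.1 w.2‖ₑ) := by
    refine mixedNorm_mono_ae (by norm_num) (by norm_num) ?_
    filter_upwards [hbd] with w hw
    rw [enorm_eq_self]
    refine (enorm_ssTensor_le _ _).trans ?_
    gcongr
    calc ‖u w.1 w.2‖ₑ ^ 2 ≤ 1 ^ 2 := by gcongr; exact enorm_le_one hw
      _ = 1 := one_pow 2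
  refine h1.trans ?_
  have hmeas : AEMeasurable (fun w : ℝ × ℝ³ => ‖((1 : ℝ≥0∞) + ‖p w.1 w.2‖ₑ)‖ₑ)
      (volume.restrict Q) := by
    simp only [enorm_eq_self]
    exact aemeasurable_const.add hpm.enorm
  rw [mixedNorm_self_eq (by norm_num) _ _ hmeas]
  refine ENNReal.rpow_le_rpow ?_ (by norm_num)
  simp only [enorm_eq_self]
  -- `(1 + |p|)^{3/2} ≤ 2^{1/2} (1 + |p|^{3/2})` pointwise
  have hpt : ∀ w : ℝ × ℝ³, ((1 : ℝ≥0∞) + ‖p w.1 w.2‖ₑ) ^ (3 / 2 : ℝ) ≤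
      (2 : ℝ≥0∞) ^ ((3 : ℝ) / 2 - 1) * (1 + ‖p w.1 w.2‖ₑ ^ (3 / 2 : ℝ)) := by
    intro w
    have h := ENNReal.rpow_add_le_mul_rpow_add_rpow (1 : ℝ≥0∞) ‖p w.1 w.2‖ₑ
      (by norm_num : (1 : ℝ) ≤ 3 / 2)
    simpa only [ENNReal.one_rpow] using h
  calc ∫⁻ w in Q, ((1 : ℝ≥0∞) + ‖p w.1 w.2‖ₑ) ^ (3 / 2 : ℝ)
      ≤ ∫⁻ w in Q, (2 : ℝ≥0∞) ^ ((3 : ℝ) / 2 - 1) * (1 + ‖p w.1 w.2‖ₑ ^ (3 / 2 : ℝ)) :=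
        lintegral_mono fun w => hpt w
    _ = (2 : ℝ≥0∞) ^ ((3 : ℝ) / 2 - 1) * (volume Q + ∫⁻ w in Q, ‖p w.1 w.2‖ₑ ^ (3 / 2 : ℝ)) := by
        rw [lintegral_const_mul' _ _
            (ENNReal.rpow_ne_top_of_nonneg (by norm_num) ENNReal.ofNat_ne_top),
          lintegral_add_left' aemeasurable_const, lintegral_const, Measure.restrict_apply_univ,
          one_mul]
    _ ≤ (2 : ℝ≥0∞) ^ ((3 : ℝ) / 2 - 1) * (volume Q + c) := by gcongr

/-- Points of `Q(a/2) = 𝒞(a/2) × ]-a²/4, 0[` are at max-distance at most `a² + 2a`. [folklore] -/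
theorem dist_le_of_mem_parCyl_half {a : ℝ} (ha : 0 < a) {z₁ z₂ : ℝ × ℝ³}
    (h₁ : z₁ ∈ parCyl 0 (a / 2)) (h₂ : z₂ ∈ parCyl 0 (a / 2)) : dist z₁ z₂ ≤ a ^ 2 + 2 * a := by
  have h₁' := parCyl_half_subset_parabolicCylinder ha h₁
  have h₂' := parCyl_half_subset_parabolicCylinder ha h₂
  rw [mem_parabolicCylinder] at h₁' h₂'
  rw [Prod.dist_eq]
  refine max_le ?_ ?_
  · rw [Real.dist_eq, abs_le]
    simp only [zero_sub] at h₁' h₂'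
    constructor <;> nlinarith [h₁'.1.1, h₁'.1.2, h₂'.1.1, h₂'.1.2]
  · have hx₁ : dist z₁.2 0 < a := by simpa using h₁'.2
    have hx₂ : dist z₂.2 0 < a := by simpa using h₂'.2
    nlinarith [dist_triangle_right z₁.2 z₂.2 0, sq_nonneg a]

/-! ### The gradient bound through the energy class -/

/-- Subadditivity of the lower Lebesgue integral over a finite union of sets. [folklore] -/
private theorem lintegral_biUnion_finset_le' {ι : Type*} (t : Finset ι) (U : ι → Set (ℝ × ℝ³))
    (F : ℝ × ℝ³ → ℝ≥0∞) :
    ∫⁻ w in ⋃ i ∈ t, U i, F w ≤ ∑ i ∈ t, ∫⁻ w in U i, F w := by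
  classical
  induction t using Finset.induction_on with
  | empty => simp
  | insert i t hi ih =>
    rw [Finset.set_biUnion_insert, Finset.sum_insert hi]
    exact (lintegral_union_le _ _ _).trans (add_le_add le_rfl ih)

/-- **Exhaustion up to the top time.** If `T` has times `< t₀` and the integral of `F ≥ 0` over
`T ∩ {t < s}` is at most `Y` for all levels `s ∈ ]t₀ - δ, t₀[`, then so is the integral over `T`
(increasing union along `sₙ = t₀ - δ/(n+2) ↑ t₀`). [folklore] -/
private theorem setLIntegral_le_of_forall_level {X : Type*} [MeasurableSpace X]
    {μ : Measure (ℝ × X)} {T : Set (ℝ × X)} {t₀ δ : ℝ} (hδ : 0 < δ) (hT : ∀ w ∈ T, w.1 < t₀)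
    {F : ℝ × X → ℝ≥0∞} {Y : ℝ≥0∞}
    (h : ∀ s, t₀ - δ < s → s < t₀ → ∫⁻ w in T ∩ {w | w.1 < s}, F w ∂μ ≤ Y) :
    ∫⁻ w in T, F w ∂μ ≤ Y := by
  set s : ℕ → ℝ := fun n => t₀ - δ / ((n : ℝ) + 2) with hs
  have hs_lt : ∀ n, s n < t₀ := fun n => by
    have : 0 < δ / ((n : ℝ) + 2) := by positivity
    simp only [hs]; linarith
  have hs_gt : ∀ n, t₀ - δ < s n := fun n => by
    have : δ / ((n : ℝ) + 2) < δ := by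
      rw [div_lt_iff₀ (by positivity)]; nlinarith [n.cast_nonneg (α := ℝ)]
    simp only [hs]; linarith
  have hmono : Monotone fun n => T ∩ {w : ℝ × X | w.1 < s n} := by
    intro m n hmn w hw
    have hmn' : (m : ℝ) + 2 ≤ (n : ℝ) + 2 := by exact_mod_cast Nat.add_le_add_right hmn 2
    have hsmn : s m ≤ s n := by
      simp only [hs]
      gcongr
    exact ⟨hw.1, lt_of_lt_of_le (α := ℝ) hw.2 hsmn⟩
  have hU : (⋃ n, T ∩ {w : ℝ × X | w.1 < s n}) = T := by
    refine subset_antisymm (iUnion_subset fun n => inter_subset_left) fun w hw => ?_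
    have hpos : 0 < t₀ - w.1 := sub_pos.2 (hT w hw)
    obtain ⟨n, hn⟩ := exists_nat_gt (δ / (t₀ - w.1))
    refine mem_iUnion.2 ⟨n, hw, ?_⟩
    show w.1 < t₀ - δ / ((n : ℝ) + 2)
    have h1 : δ / (t₀ - w.1) < (n : ℝ) + 2 := hn.trans (by linarith)
    rw [div_lt_iff₀ hpos] at h1
    have h2 : δ / ((n : ℝ) + 2) < t₀ - w.1 := by
      rw [div_lt_iff₀ (by positivity)]; linarith
    linarith
  rw [← hU, setLIntegral_iUnion_of_directed _ hmono.directed_le]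
  exact iSup_le fun n => h (s n) (hs_gt n) (hs_lt n)

/-- **The gradient bound `‖∇u‖_{3/2} ≤ c₂` through the energy class** (replacing the appeal to
[LSU] of Seregin–Šverák 2009, §4 p. 11; same paper, §2 p. 6: bounded distributional solutions
with `L_{3/2}` pressure are suitable weak solutions). For a centre `z₀`, radii `0 < r < R` and
`c ≥ 0` there is a finite `N = N(z₀, r, R, c)` such that every distributional Navier–Stokes solution
`(u, p)` (`ν = 1`, no force) in `Q(z₀, R)` with `|u| ≤ 1` a.e. and `∫∫_{Q(z₀,R)} |p|^{3/2} ≤ c` has a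
weak spatial gradient `G = ∇u` on `Q(z₀, R)` with `‖∇u‖_{3/2,Q(z₀,r)} ≤ N`. Proof: the pair is a
suitable weak solution on `Q(z₀, R)` (`isSuitableWeakSolutionOn_of_bounded`); with `ρ = (R - r)/4`,
the absolute local energy bound `localEnergyBound` (Caffarelli–Kohn–Nirenberg) on a cylinder
`Q(ζ, 2ρ)` with closure in `Q(z₀, R)` bounds `∫∫_{Q(ζ,ρ)} |∇u|²` by `P = ρ B` with `B` independent of
the data (`C(2ρ) ≤ (2ρ)⁻² |Q(z₀,R)|` as `|u| ≤ 1`, `D(2ρ) ≤ (2ρ)⁻² c`, `F = 0`); below every time level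
`s` close to the top, `Q(z₀, r) ∩ {t < s}` is covered by a fixed finite family of such cylinders
(a finite subcover of the compact body `[t₀ - r², t₀ - ρ²/4] × B̄(x₀, r)` by the cylinders
`Q((t + ρ²/8, x), ρ)`) together with the cylinders `Q((s, y), ρ)`, `y` in a finite `ρ`-net of
`B̄(x₀, r)`, so `∫∫ |∇u|²` over it is at most `(n₁ + n₂) P`; the exhaustion passes to `Q(z₀, r)`, and
Hölder's inequality on the bounded cylinder converts the `L²` bound into an `L_{3/2}` bound.
[cite: SereginSverak2009, §2 p. 6 ((b8)–(b10): "in fact a suitable weak solution") and §4 p. 11; CaffarelliKohnNirenberg1982, §2 (2.5), Lemma 5.1] -/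
theorem exists_weakGradient_bound_of_bounded (z₀ : ℝ × ℝ³) {r R : ℝ} (hr : 0 < r) (hrR : r < R)
    (c : ℝ≥0) :
    ∃ N : ℝ≥0∞, N < ∞ ∧ ∀ (u : ℝ → ℝ³ → ℝ³) (p : ℝ → ℝ³ → ℝ),
      IsDistributionalNSSolutionOn (parabolicCylinderOpens R z₀) 1 0 u p →
      (∀ᵐ w ∂(volume.restrict (parabolicCylinder R z₀)), ‖u w.1 w.2‖ ≤ 1) →
      (∫⁻ w in parabolicCylinder R z₀, ‖p w.1 w.2‖ₑ ^ (3 / 2 : ℝ) ≤ c) →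
      ∃ G : ℝ → ℝ³ → ℝ³ →L[ℝ] ℝ³, HasWeakSpatialGradientOn (parabolicCylinderOpens R z₀) u G ∧
        mixedNorm (3 / 2) (3 / 2) z₀ r (uncurry G) ≤ N := by
  obtain ⟨c₁, c₂, c₃, c₄, H⟩ := localEnergyBound (one_pos : (0 : ℝ) < 1)
  have hR : 0 < R := hr.trans hrR
  -- the small radius `ρ = (R - r)/4`
  set ρ : ℝ := (R - r) / 4 with hρ
  have hρ0 : 0 < ρ := by rw [hρ]; linarith
  have hρ2 : 0 < ρ ^ 2 := by positivity
  have hρ4 : 4 * ρ ≤ R := by rw [hρ]; linarith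
  have htime : r ^ 2 + 4 * ρ ^ 2 < R ^ 2 := by
    have hd : 0 < R - r := sub_pos.2 hrR
    rw [hρ]; nlinarith
  -- the data-independent constants
  set V : ℝ≥0∞ := volume (parabolicCylinder R z₀) with hV
  have hV_lt : V < ∞ := parabolicCylinder_volume_lt_top _ _
  have h2ρ : ENNReal.ofReal (2 * ρ) ≠ 0 := (ENNReal.ofReal_pos.2 (by positivity)).ne'
  have hinv_lt : (ENNReal.ofReal (2 * ρ) ^ 2)⁻¹ < ∞ :=
    ENNReal.inv_lt_top.2 (pos_iff_ne_zero.2 (pow_ne_zero 2 h2ρ))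
  set C₀ : ℝ≥0∞ := (ENNReal.ofReal (2 * ρ) ^ 2)⁻¹ * V with hC₀
  have hC₀_lt : C₀ < ∞ := ENNReal.mul_lt_top hinv_lt hV_lt
  set D₀ : ℝ≥0∞ := (ENNReal.ofReal (2 * ρ) ^ 2)⁻¹ * c with hD₀
  have hD₀_lt : D₀ < ∞ := ENNReal.mul_lt_top hinv_lt ENNReal.coe_lt_top
  set θ : ℝ := 1 / 2 with hθ
  set B : ℝ≥0∞ := c₁ * ENNReal.ofReal (θ ^ 2) * C₀ ^ (2 / 3 : ℝ) +
      c₂ * ENNReal.ofReal (θ ^ 2)⁻¹ * C₀ +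
      c₃ * ENNReal.ofReal (θ ^ 2)⁻¹ * D₀ ^ (2 / 3 : ℝ) * C₀ ^ (1 / 3 : ℝ) +
      c₄ * ENNReal.ofReal θ⁻¹ * (0 : ℝ≥0∞) ^ (1 / (3 / 2 : ℝ)) * C₀ ^ (1 / 3 : ℝ) with hB
  have hB_lt : B < ∞ := by
    have hr' : ∀ {x : ℝ≥0∞} {e : ℝ}, 0 ≤ e → x < ∞ → x ^ e < ∞ := fun he hx =>
      ENNReal.rpow_lt_top_of_nonneg he hx.ne
    have hm : ∀ {x y : ℝ≥0∞}, x < ∞ → y < ∞ → x * y < ∞ := fun hx hy => ENNReal.mul_lt_top hx hy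
    refine ENNReal.add_lt_top.2 ⟨ENNReal.add_lt_top.2 ⟨ENNReal.add_lt_top.2 ⟨?_, ?_⟩, ?_⟩, ?_⟩
    · exact hm (hm ENNReal.coe_lt_top ENNReal.ofReal_lt_top) (hr' (by norm_num) hC₀_lt)
    · exact hm (hm ENNReal.coe_lt_top ENNReal.ofReal_lt_top) hC₀_lt
    · exact hm (hm (hm ENNReal.coe_lt_top ENNReal.ofReal_lt_top) (hr' (by norm_num) hD₀_lt))
        (hr' (by norm_num) hC₀_lt)
    · exact hm (hm (hm ENNReal.coe_lt_top ENNReal.ofReal_lt_top)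
        (hr' (by norm_num) ENNReal.zero_lt_top)) (hr' (by norm_num) hC₀_lt)
  set P : ℝ≥0∞ := ENNReal.ofReal ρ * B with hP
  have hP_lt : P < ∞ := ENNReal.mul_lt_top ENNReal.ofReal_lt_top hB_lt
  -- the finite cover of the body `[t₀ - r², t₀ - ρ²/4] × B̄(x₀, r)`
  set Kb : Set (ℝ × ℝ³) := Icc (z₀.1 - r ^ 2) (z₀.1 - ρ ^ 2 / 4) ×ˢ closedBall z₀.2 r with hKb
  have hKb_cpt : IsCompact Kb := isCompact_Icc.prod (isCompact_closedBall _ _)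
  set U : Kb → Set (ℝ × ℝ³) := fun i =>
    parabolicCylinder ρ ((i : ℝ × ℝ³).1 + ρ ^ 2 / 8, (i : ℝ × ℝ³).2) with hU
  have hUo : ∀ i, IsOpen (U i) := fun i => isOpen_parabolicCylinder _ _
  have hKU : Kb ⊆ ⋃ i, U i := by
    intro ζ hζ
    refine mem_iUnion.2 ⟨⟨ζ, hζ⟩, ?_⟩
    simp only [hU, mem_parabolicCylinder, dist_self]
    exact ⟨⟨by linarith, by linarith⟩, hρ0⟩
  obtain ⟨tb, htb⟩ := hKb_cpt.elim_finite_subcover U hUo hKU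
  -- the finite `ρ`-net of the ball for the top layer
  obtain ⟨Y, hYsub, hYfin, hYcov⟩ :=
    finite_cover_balls_of_compact (isCompact_closedBall z₀.2 r) hρ0
  set NL : ℝ≥0∞ := ((tb.card : ℝ≥0∞) + (hYfin.toFinset.card : ℝ≥0∞)) * P with hNL
  have hNL_lt : NL < ∞ :=
    ENNReal.mul_lt_top (ENNReal.add_lt_top.2 ⟨ENNReal.natCast_lt_top _, ENNReal.natCast_lt_top _⟩)
      hP_lt
  -- the Hölder constants on `T = Q(z₀, r)`
  set T : Set (ℝ × ℝ³) := parabolicCylinder r z₀ with hT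
  have hTvol : volume T < ∞ := parabolicCylinder_volume_lt_top _ _
  set e : ℝ := 1 / (ENNReal.ofReal (3 / 2)).toReal - 1 / (2 : ℝ≥0∞).toReal with he
  have he' : e = 1 / 6 := by
    rw [he, ENNReal.toReal_ofReal (by norm_num)]; norm_num
  set N : ℝ≥0∞ := NL ^ (1 / 2 : ℝ) * volume T ^ e with hN
  have hN_lt : N < ∞ :=
    ENNReal.mul_lt_top (ENNReal.rpow_lt_top_of_nonneg (by norm_num) hNL_lt.ne)
      (ENNReal.rpow_lt_top_of_nonneg (by rw [he']; norm_num) hTvol.ne)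
  refine ⟨N, hN_lt, fun u p hNS hbd hp => ?_⟩
  -- the pair is a suitable weak solution on `Q(z₀, R)`
  have hΩ : volume ((parabolicCylinderOpens R z₀ : Opens (ℝ × ℝ³)) : Set (ℝ × ℝ³)) < ∞ :=
    parabolicCylinder_volume_lt_top _ _
  have hp' : ∫⁻ w in ((parabolicCylinderOpens R z₀ : Opens (ℝ × ℝ³)) : Set (ℝ × ℝ³)),
      ‖p w.1 w.2‖ₑ ^ (3 / 2 : ℝ) < ∞ := lt_of_le_of_lt hp ENNReal.coe_lt_top
  have hsuit : IsSuitableWeakSolutionOn (parabolicCylinderOpens R z₀) 1 0 u p :=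
    isSuitableWeakSolutionOn_of_bounded one_pos hNS hΩ hbd hp'
  obtain ⟨G, hG, -, -⟩ := hsuit.localEnergy
  refine ⟨G, hG, ?_⟩
  have hu3 : ∀ᵐ w ∂(volume.restrict (parabolicCylinder R z₀)), ‖u w.1 w.2‖ₑ ^ (3 : ℕ) ≤ 1 := by
    filter_upwards [hbd] with w hw
    calc ‖u w.1 w.2‖ₑ ^ (3 : ℕ) ≤ 1 ^ (3 : ℕ) := by gcongr; exact enorm_le_one hw
      _ = 1 := one_pow 3
  -- the `L²` bound `P` on every small cylinder `Q(ζ, ρ)` whose double has closure in `Q(z₀, R)`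
  have hpiece : ∀ ζ : ℝ × ℝ³, ζ.1 < z₀.1 → z₀.1 - R ^ 2 < ζ.1 - (2 * ρ) ^ 2 →
      dist ζ.2 z₀.2 ≤ r →
      ∫⁻ w in parabolicCylinder ρ ζ, ENNReal.ofReal (frobeniusNormSq (G w.1 w.2)) ≤ P := by
    intro ζ h₁ h₂ h₃
    have hcl : closure (parabolicCylinder (2 * ρ) ζ) ⊆
        ((parabolicCylinderOpens R z₀ : Opens (ℝ × ℝ³)) : Set (ℝ × ℝ³)) := by
      refine (closure_parabolicCylinder_subset (2 * ρ) ζ).trans ?_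
      rintro w ⟨hw1, hw2⟩
      rw [mem_Icc] at hw1
      rw [mem_closedBall] at hw2
      rw [coe_parabolicCylinderOpens, mem_parabolicCylinder]
      refine ⟨⟨by linarith [hw1.1], by linarith [hw1.2]⟩, ?_⟩
      calc dist w.2 z₀.2 ≤ dist w.2 ζ.2 + dist ζ.2 z₀.2 := dist_triangle _ _ _
        _ ≤ 2 * ρ + r := add_le_add hw2 h₃
        _ < R := by rw [hρ]; linarith
    have hsub : parabolicCylinder (2 * ρ) ζ ⊆ parabolicCylinder R z₀ := subset_closure.trans hcl
    have key := H (parabolicCylinderOpens R z₀) (3 / 2) 0 u p G hsuit le_rfl MemLp.zero hG ζ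
      (2 * ρ) θ (by positivity) (by norm_num) (by norm_num) hcl
    have hC : cknC (2 * ρ) ζ u ≤ C₀ := by
      rw [cknC, hC₀]
      gcongr
      calc ∫⁻ w in parabolicCylinder (2 * ρ) ζ, ‖u w.1 w.2‖ₑ ^ (3 : ℕ)
          ≤ ∫⁻ w in parabolicCylinder R z₀, ‖u w.1 w.2‖ₑ ^ (3 : ℕ) := lintegral_mono_set hsub
        _ ≤ ∫⁻ _ in parabolicCylinder R z₀, (1 : ℝ≥0∞) := lintegral_mono_ae hu3
        _ = V := by rw [lintegral_const, Measure.restrict_apply_univ, one_mul]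
    have hD : cknD (2 * ρ) ζ p ≤ D₀ := by
      rw [cknD, hD₀]
      gcongr
      exact (lintegral_mono_set hsub).trans hp
    have hF : cknF (3 / 2) (2 * ρ) ζ 0 = 0 := by
      simp [cknF, ENNReal.zero_rpow_of_pos]
    rw [hF] at key
    have hE : cknE (θ * (2 * ρ)) ζ G ≤ B :=
      calc cknE (θ * (2 * ρ)) ζ G ≤ cknAEss (θ * (2 * ρ)) ζ u + cknE (θ * (2 * ρ)) ζ G :=
            le_add_self
        _ ≤ _ := key
        _ ≤ B := by rw [hB]; gcongr
    have hθρ : θ * (2 * ρ) = ρ := by rw [hθ]; ring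
    rw [hθρ, cknE] at hE
    have hr0 : ENNReal.ofReal ρ ≠ 0 := (ENNReal.ofReal_pos.2 hρ0).ne'
    calc ∫⁻ w in parabolicCylinder ρ ζ, ENNReal.ofReal (frobeniusNormSq (G w.1 w.2))
        = ENNReal.ofReal ρ * ((ENNReal.ofReal ρ)⁻¹ *
            ∫⁻ w in parabolicCylinder ρ ζ, ENNReal.ofReal (frobeniusNormSq (G w.1 w.2))) := by
          rw [← mul_assoc, ENNReal.mul_inv_cancel hr0 ENNReal.ofReal_ne_top, one_mul]
      _ ≤ ENNReal.ofReal ρ * B := by gcongr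
  -- the pieces of the two finite families are such cylinders
  have hbody : ∀ i : Kb, ∫⁻ w in U i, ENNReal.ofReal (frobeniusNormSq (G w.1 w.2)) ≤ P := by
    intro i
    obtain ⟨hi1, hi2⟩ := mem_prod.1 i.2
    rw [mem_Icc] at hi1
    rw [mem_closedBall] at hi2
    refine hpiece _ ?_ ?_ hi2 <;> dsimp only
    · linarith [hi1.2]
    · nlinarith [hi1.1, htime]
  have htop : ∀ s : ℝ, z₀.1 - ρ ^ 2 / 8 < s → s < z₀.1 → ∀ y ∈ Y,
      ∫⁻ w in parabolicCylinder ρ (s, y), ENNReal.ofReal (frobeniusNormSq (G w.1 w.2)) ≤ P := by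
    intro s hs₁ hs₂ y hy
    refine hpiece (s, y) hs₂ ?_ (mem_closedBall.1 (hYsub hy))
    dsimp only
    nlinarith [hρ4, hρ0]
  -- the bound below every level `s` close to the top, uniformly in `s`
  have hlevel : ∀ s : ℝ, z₀.1 - ρ ^ 2 / 8 < s → s < z₀.1 →
      ∫⁻ w in T ∩ {w | w.1 < s}, ENNReal.ofReal (frobeniusNormSq (G w.1 w.2)) ≤ NL := by
    intro s hs₁ hs₂
    have hcover : T ∩ {w : ℝ × ℝ³ | w.1 < s} ⊆
        (⋃ i ∈ tb, U i) ∪ ⋃ y ∈ hYfin.toFinset, parabolicCylinder ρ (s, y) := by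
      rintro w ⟨hwT, hws⟩
      rw [hT, mem_parabolicCylinder] at hwT
      obtain ⟨⟨hw1, -⟩, hw3⟩ := hwT
      by_cases hwt : w.1 ≤ z₀.1 - ρ ^ 2 / 4
      · exact Or.inl (htb (mk_mem_prod ⟨hw1.le, hwt⟩ (mem_closedBall.2 hw3.le)))
      · rw [not_le] at hwt
        obtain ⟨y, hy, hyw⟩ := mem_iUnion₂.1 (hYcov (mem_closedBall.2 hw3.le))
        refine Or.inr (mem_iUnion₂.2 ⟨y, hYfin.mem_toFinset.2 hy, ?_⟩)
        rw [mem_parabolicCylinder]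
        exact ⟨⟨by dsimp only; linarith, hws⟩, mem_ball.1 hyw⟩
    calc ∫⁻ w in T ∩ {w | w.1 < s}, ENNReal.ofReal (frobeniusNormSq (G w.1 w.2))
        ≤ ∫⁻ w in (⋃ i ∈ tb, U i) ∪ ⋃ y ∈ hYfin.toFinset, parabolicCylinder ρ (s, y),
            ENNReal.ofReal (frobeniusNormSq (G w.1 w.2)) := lintegral_mono_set hcover
      _ ≤ (∫⁻ w in ⋃ i ∈ tb, U i, ENNReal.ofReal (frobeniusNormSq (G w.1 w.2))) +
            ∫⁻ w in ⋃ y ∈ hYfin.toFinset, parabolicCylinder ρ (s, y),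
              ENNReal.ofReal (frobeniusNormSq (G w.1 w.2)) := lintegral_union_le _ _ _
      _ ≤ (∑ i ∈ tb, ∫⁻ w in U i, ENNReal.ofReal (frobeniusNormSq (G w.1 w.2))) +
            ∑ y ∈ hYfin.toFinset, ∫⁻ w in parabolicCylinder ρ (s, y),
              ENNReal.ofReal (frobeniusNormSq (G w.1 w.2)) :=
          add_le_add (lintegral_biUnion_finset_le' _ _ _) (lintegral_biUnion_finset_le' _ _ _)
      _ ≤ (∑ _i ∈ tb, P) + ∑ _y ∈ hYfin.toFinset, P :=
          add_le_add (Finset.sum_le_sum fun i _ => hbody i)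
            (Finset.sum_le_sum fun y hy => htop s hs₁ hs₂ y (hYfin.mem_toFinset.1 hy))
      _ = NL := by
          rw [Finset.sum_const, Finset.sum_const, nsmul_eq_mul, nsmul_eq_mul, hNL, add_mul]
  -- exhaustion up to the top time
  have hL2 : ∫⁻ w in T, ENNReal.ofReal (frobeniusNormSq (G w.1 w.2)) ≤ NL :=
    setLIntegral_le_of_forall_level (by positivity : 0 < ρ ^ 2 / 8)
      (fun w hw => by rw [hT, mem_parabolicCylinder] at hw; exact hw.1.2) hlevel
  -- from `L²` to `L_{3/2}` on the bounded cylinder `T = Q(z₀, r)`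
  have hTle : (parabolicCylinderOpens r z₀ : Opens (ℝ × ℝ³)) ≤ parabolicCylinderOpens R z₀ :=
    fun w hw => parabolicCylinder_mono hr.le hrR.le z₀ hw
  have hGm : AEStronglyMeasurable (uncurry G) (volume.restrict T) :=
    (hG.mono hTle).locallyIntegrableOn_grad.aestronglyMeasurable
  have h32 : ENNReal.ofReal (3 / 2 : ℝ) ≤ (2 : ℝ≥0∞) := by
    rw [show (2 : ℝ≥0∞) = ENNReal.ofReal 2 by simp]
    exact ENNReal.ofReal_le_ofReal (by norm_num)
  have hp0 : ENNReal.ofReal (3 / 2 : ℝ) ≠ 0 := (ENNReal.ofReal_pos.2 (by norm_num)).ne'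
  have e1 : mixedNorm (3 / 2) (3 / 2) z₀ r (uncurry G) =
      eLpNorm (uncurry G) (ENNReal.ofReal (3 / 2)) (volume.restrict T) := by
    rw [mixedNorm_self_eq (by norm_num) z₀ _ hGm.enorm,
      eLpNorm_eq_lintegral_rpow_enorm_toReal hp0 ENNReal.ofReal_ne_top,
      ENNReal.toReal_ofReal (by norm_num)]
  have e2 : eLpNorm (uncurry G) (ENNReal.ofReal (3 / 2)) (volume.restrict T) ≤
      eLpNorm (uncurry G) 2 (volume.restrict T) * volume T ^ e := by
    have h := eLpNorm_le_eLpNorm_mul_rpow_measure_univ h32 hGm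
    rwa [Measure.restrict_apply_univ] at h
  have e3 : eLpNorm (uncurry G) 2 (volume.restrict T) ≤ NL ^ (1 / 2 : ℝ) := by
    rw [eLpNorm_eq_lintegral_rpow_enorm_toReal two_ne_zero ENNReal.ofNat_ne_top,
      ENNReal.toReal_ofNat]
    refine ENNReal.rpow_le_rpow ?_ (by norm_num)
    calc ∫⁻ w in T, ‖uncurry G w‖ₑ ^ (2 : ℝ)
        ≤ ∫⁻ w in T, ENNReal.ofReal (frobeniusNormSq (G w.1 w.2)) :=
          lintegral_mono fun w =>
            SerrinBoundedHolder.enorm_rpow_two_le_ofReal_frobeniusNormSq (G w.1 w.2)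
      _ ≤ NL := hL2
  calc mixedNorm (3 / 2) (3 / 2) z₀ r (uncurry G)
      = eLpNorm (uncurry G) (ENNReal.ofReal (3 / 2)) (volume.restrict T) := e1
    _ ≤ eLpNorm (uncurry G) 2 (volume.restrict T) * volume T ^ e := e2
    _ ≤ NL ^ (1 / 2 : ℝ) * volume T ^ e := by gcongr
    _ = N := rfl

/-! ### The assembly -/

/-- **Seregin–Šverák 2009, §4: the uniform local Hölder bound from the linear theory**
(arXiv:0804.1803 p. 11; `LocalHolderBound` of `FluidPDE/SereginSverakBlowup`). The printed chain,
with every constant uniform in the data: on the ball cylinder `Q(4a) ⊆ 𝒞(4a) × ]-16a², 0[` the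
pair is a bounded distributional solution with `L_{3/2}` pressure, hence (energy class, §2 p. 6,
and the local energy bound, in place of the paper's appeal to [LSU]:
`exists_weakGradient_bound_of_bounded`) has a weak spatial gradient with
`‖∇u‖_{3/2,Q(3a)} ≤ c₂(a, c)`; the pair then solves the Stokes system with `f = -u·∇u` in `Q(3a)`
(`isDistributionalStokesSolutionOn_of_isDistributionalNSSolutionOn`), `‖f‖ ≤ ‖∇u‖`
(`mixedNorm_force_le`); two rounds of the local Stokes theory, Seregin 2014 Prop. 6.7
(`StokesLocalW21Estimate`), with the Sobolev embedding (`stokesLocalIntegrabilityGain_of_W21`,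
`3/2 → 3` on `Q(2a)`, `3 → 6` on `Q(3a/2)`) and a last round with
the parabolic embedding (`StokesLocalHolderBound`, `s = 6`, `n = 3/2`, `μ = 1/6`) give a
representative of `u` on `Q(a)` with a uniform parabolic `C^{1/6}` bound, which on
`Q(a/2) = 𝒞(a/2) × ]-a²/4, 0[ ⊆ Q(a)` is a uniform `HolderOnWith` bound of exponent `1/12` for the
max product metric (`holderOnWith_of_parabolic`).
[cite: SereginSverak2009, §4, (p12) and the displayed estimates following it, arXiv p. 11; §2 p. 6] -/
theorem localHolderBound_of (hB : StokesLocalW21Estimate) (hC : StokesLocalHolderBound) :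
    LocalHolderBound := by
  intro a ha c
  -- the centre, the exponent and the constants of the facts
  set z₀ : ℝ × ℝ³ := ((0 : ℝ), (0 : ℝ³)) with hz₀
  set μ : ℝ := 2 - 2 / (3 / 2 : ℝ) - 3 / 6 with hμ
  have hμ0 : 0 < μ := by rw [hμ]; norm_num
  obtain ⟨N₁, hN₁_lt, hEn⟩ :=
    exists_weakGradient_bound_of_bounded z₀ (r := 3 * a) (R := 4 * a) (by positivity) (by linarith) c
  obtain ⟨CB₁, hCB₁⟩ := stokesLocalIntegrabilityGain_of_W21 hB z₀ (2 * a) (3 * a) (3 / 2) 3 (3 / 2)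
    (by positivity) (by linarith) (by norm_num) (by norm_num) (by norm_num) (by norm_num)
  obtain ⟨CB₂, hCB₂⟩ := stokesLocalIntegrabilityGain_of_W21 hB z₀ (3 * a / 2) (2 * a) 3 6 (3 / 2)
    (by positivity) (by linarith) (by norm_num) (by norm_num) (by norm_num) (by norm_num)
  obtain ⟨CC, hCC⟩ := hC z₀ a (3 * a / 2) 6 (3 / 2) ha (by linarith) (by norm_num) (by norm_num)
    (by norm_num) (by rw [← hμ]; exact hμ0)
  -- the data-independent bounds
  set Ub : ℝ → ℝ → ℝ → ℝ≥0∞ := fun s n R =>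
    (((1 : ℝ≥0∞) ^ s * volume (ball z₀.2 R)) ^ (n / s) * volume (Ioo (z₀.1 - R ^ 2) z₀.1)) ^ (1 / n)
    with hUb
  have hUb_lt : ∀ s n R, 0 ≤ s → 0 < n → Ub s n R < ∞ := fun s n R hs hn =>
    mixedNorm_const_lt_top hs hn z₀ R ENNReal.one_ne_top
  set Cp : ℝ≥0∞ := (c : ℝ≥0∞) ^ (1 / (3 / 2 : ℝ)) with hCp
  have hCp_lt : Cp < ∞ := ENNReal.rpow_lt_top_of_nonneg (by norm_num) ENNReal.coe_ne_top
  set N₂ : ℝ≥0∞ := CB₁ * (N₁ + Ub (3 / 2) (3 / 2) (3 * a) + N₁ + Cp) with hN₂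
  have hN₂_lt : N₂ < ∞ := by
    refine ENNReal.mul_lt_top ENNReal.coe_lt_top ?_
    exact ENNReal.add_lt_top.2 ⟨ENNReal.add_lt_top.2 ⟨ENNReal.add_lt_top.2
      ⟨hN₁_lt, hUb_lt _ _ _ (by norm_num) (by norm_num)⟩, hN₁_lt⟩, hCp_lt⟩
  set N₃ : ℝ≥0∞ := CB₂ * (N₂ + Ub 3 (3 / 2) (2 * a) + N₂ + N₂) with hN₃
  have hN₃_lt : N₃ < ∞ := by
    refine ENNReal.mul_lt_top ENNReal.coe_lt_top ?_
    exact ENNReal.add_lt_top.2 ⟨ENNReal.add_lt_top.2 ⟨ENNReal.add_lt_top.2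
      ⟨hN₂_lt, hUb_lt _ _ _ (by norm_num) (by norm_num)⟩, hN₂_lt⟩, hN₂_lt⟩
  set N₄ : ℝ≥0∞ := N₃ + Ub 6 (3 / 2) (3 * a / 2) + N₃ + N₃ with hN₄
  have hN₄_lt : N₄ < ∞ :=
    ENNReal.add_lt_top.2 ⟨ENNReal.add_lt_top.2 ⟨ENNReal.add_lt_top.2
      ⟨hN₃_lt, hUb_lt _ _ _ (by norm_num) (by norm_num)⟩, hN₃_lt⟩, hN₃_lt⟩
  have hK_ne : (CC : ℝ≥0∞) * N₄ ≠ ∞ := (ENNReal.mul_lt_top ENNReal.coe_lt_top hN₄_lt).ne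
  -- the Hölder exponent and constant
  refine ⟨(μ / 2).toNNReal,
    ((CC : ℝ≥0∞) * N₄).toNNReal * ((Real.sqrt (a ^ 2 + 2 * a) + 1) ^ μ).toNNReal,
    Real.toNNReal_pos.2 (by positivity), fun u p hNS hbd hp => ?_⟩
  /- Step 1: restriction to the ball cylinder `Q(4a)` -/
  have hsub₄ : parabolicCylinder (4 * a) z₀ ⊆ parCyl 0 (4 * a) :=
    parabolicCylinder_origin_subset_parCyl (4 * a)
  have hNS₄ : IsDistributionalNSSolutionOn (parabolicCylinderOpens (4 * a) z₀) 1 0 u p :=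
    hNS.of_le (fun w hw => hsub₄ hw)
  have hbd₄ : ∀ᵐ w ∂(volume.restrict (parabolicCylinder (4 * a) z₀)), ‖u w.1 w.2‖ ≤ 1 :=
    ae_restrict_of_ae_restrict_of_subset hsub₄ hbd
  have hp₄ : ∫⁻ w in parabolicCylinder (4 * a) z₀, ‖p w.1 w.2‖ₑ ^ (3 / 2 : ℝ) ≤ c :=
    (lintegral_mono_set hsub₄).trans hp
  -- inclusions of the smaller cylinders
  have h34 : parabolicCylinder (3 * a) z₀ ⊆ parabolicCylinder (4 * a) z₀ :=
    parabolicCylinder_mono (by positivity) (by linarith) z₀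
  have h23 : parabolicCylinder (2 * a) z₀ ⊆ parabolicCylinder (3 * a) z₀ :=
    parabolicCylinder_mono (by positivity) (by linarith) z₀
  have h13 : parabolicCylinder (3 * a / 2) z₀ ⊆ parabolicCylinder (3 * a) z₀ :=
    parabolicCylinder_mono (by positivity) (by linarith) z₀
  have h01 : parabolicCylinder a z₀ ⊆ parabolicCylinder (3 * a / 2) z₀ :=
    parabolicCylinder_mono ha.le (by linarith) z₀
  -- bounds for `u` on every cylinder inside `Q(4a)`
  have hbdR : ∀ {R : ℝ}, parabolicCylinder R z₀ ⊆ parabolicCylinder (4 * a) z₀ →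
      ∀ᵐ w ∂(volume.restrict (parabolicCylinder R z₀)), ‖u w.1 w.2‖ ≤ 1 := fun hR =>
    ae_restrict_of_ae_restrict_of_subset hR hbd₄
  have hU : ∀ {R : ℝ} (s n : ℝ), 0 ≤ s → 0 < n →
      parabolicCylinder R z₀ ⊆ parabolicCylinder (4 * a) z₀ →
      mixedNorm s n z₀ R (uncurry u) ≤ Ub s n R := by
    intro R s n hs hn hR
    refine mixedNorm_le_of_ae_le hs hn ?_
    filter_upwards [hbdR hR] with w hw
    exact enorm_le_one hw
  /- Step 2: the weak gradient and its `L_{3/2}` bound on `Q(3a)` through the energy class -/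
  obtain ⟨G, hG₄, hG₁⟩ := hEn u p hNS₄ hbd₄ hp₄
  have hG : HasWeakSpatialGradientOn (parabolicCylinderOpens (3 * a) z₀) u G :=
    hG₄.mono (fun w hw => h34 hw)
  /- Step 3: the Stokes system with `f = -(∇u) u` on `Q(3a)` -/
  have hNS₃ : IsDistributionalNSSolutionOn (parabolicCylinderOpens (3 * a) z₀) 1 0 u p :=
    hNS₄.of_le (fun w hw => h34 hw)
  have hGm : AEStronglyMeasurable (uncurry G) (volume.restrict (parabolicCylinder (3 * a) z₀)) :=
    hG.locallyIntegrableOn_grad.aestronglyMeasurable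
  have hGI : IntegrableOn (uncurry G) (parabolicCylinder (3 * a) z₀) volume :=
    integrableOn_of_mixedNorm_lt_top (by norm_num) hGm (hG₁.trans_lt hN₁_lt)
  set f : ℝ → ℝ³ → ℝ³ := fun t x => -(G t x (u t x)) with hf
  have hSt₃ : IsDistributionalStokesSolutionOn (parabolicCylinderOpens (3 * a) z₀) f u p :=
    isDistributionalStokesSolutionOn_of_isDistributionalNSSolutionOn hNS₃ hG zero_le_one
      (hbdR h34) hGI
  have hf_le : ∀ {R : ℝ} (s n : ℝ), 0 ≤ s → 0 < n →
      parabolicCylinder R z₀ ⊆ parabolicCylinder (4 * a) z₀ →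
      mixedNorm s n z₀ R (uncurry f) ≤ mixedNorm s n z₀ R (uncurry G) :=
    fun s n hs hn hR => mixedNorm_force_le hs hn (hbdR hR)
  have hp₃ : mixedNorm (3 / 2) (3 / 2) z₀ (3 * a) (uncurry p) ≤ Cp :=
    mixedNorm_pressure_le (h34.trans hsub₄) hNS₃.2.2.1.aestronglyMeasurable hp
  /- Step 4: first round, `3/2 → 3` on `Q(2a)` -/
  have hR1 : mixedNorm 3 (3 / 2) z₀ (2 * a) (uncurry G) + mixedNorm 3 (3 / 2) z₀ (2 * a) (uncurry p)
      ≤ N₂ := by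
    have h := hCB₁ u f p G hSt₃ hG
      ((hU _ _ (by norm_num) (by norm_num) h34).trans_lt (hUb_lt _ _ _ (by norm_num) (by norm_num)))
      (hG₁.trans_lt hN₁_lt) (hp₃.trans_lt hCp_lt)
      (((hf_le _ _ (by norm_num) (by norm_num) h34).trans hG₁).trans_lt hN₁_lt)
    have e1 := (hf_le (R := 3 * a) (3 / 2) (3 / 2) (by norm_num) (by norm_num) h34).trans hG₁
    have e2 := hU (R := 3 * a) (3 / 2) (3 / 2) (by norm_num) (by norm_num) h34
    refine h.trans ?_
    rw [hN₂]
    gcongr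
  have hG₂ : mixedNorm 3 (3 / 2) z₀ (2 * a) (uncurry G) ≤ N₂ := le_trans le_self_add hR1
  have hp₂ : mixedNorm 3 (3 / 2) z₀ (2 * a) (uncurry p) ≤ N₂ := le_trans le_add_self hR1
  /- Step 5: second round, `3 → 6` on `Q(3a/2)` -/
  have hSt₂ : IsDistributionalStokesSolutionOn (parabolicCylinderOpens (2 * a) z₀) f u p :=
    hSt₃.of_le (fun w hw => h23 hw)
  have hGw₂ : HasWeakSpatialGradientOn (parabolicCylinderOpens (2 * a) z₀) u G :=
    hG.mono (fun w hw => h23 hw)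
  have hR2 : mixedNorm 6 (3 / 2) z₀ (3 * a / 2) (uncurry G) +
      mixedNorm 6 (3 / 2) z₀ (3 * a / 2) (uncurry p) ≤ N₃ := by
    have h24 := h23.trans h34
    have h := hCB₂ u f p G hSt₂ hGw₂
      ((hU _ _ (by norm_num) (by norm_num) h24).trans_lt (hUb_lt _ _ _ (by norm_num) (by norm_num)))
      (hG₂.trans_lt hN₂_lt) (hp₂.trans_lt hN₂_lt)
      (((hf_le _ _ (by norm_num) (by norm_num) h24).trans hG₂).trans_lt hN₂_lt)
    have e1 := (hf_le (R := 2 * a) 3 (3 / 2) (by norm_num) (by norm_num) h24).trans hG₂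
    have e2 := hU (R := 2 * a) 3 (3 / 2) (by norm_num) (by norm_num) h24
    refine h.trans ?_
    rw [hN₃]
    gcongr
  have hG₃ : mixedNorm 6 (3 / 2) z₀ (3 * a / 2) (uncurry G) ≤ N₃ := le_trans le_self_add hR2
  have hp₁ : mixedNorm 6 (3 / 2) z₀ (3 * a / 2) (uncurry p) ≤ N₃ := le_trans le_add_self hR2
  /- Step 6: the parabolic Hölder bound on `Q(a)` -/
  have hSt₁ : IsDistributionalStokesSolutionOn (parabolicCylinderOpens (3 * a / 2) z₀) f u p :=
    hSt₃.of_le (fun w hw => h13 hw)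
  have hGw₁ : HasWeakSpatialGradientOn (parabolicCylinderOpens (3 * a / 2) z₀) u G :=
    hG.mono (fun w hw => h13 hw)
  have h14 := h13.trans h34
  have hsum : mixedNorm 6 (3 / 2) z₀ (3 * a / 2) (uncurry f) +
      mixedNorm 6 (3 / 2) z₀ (3 * a / 2) (uncurry u) +
      mixedNorm 6 (3 / 2) z₀ (3 * a / 2) (uncurry G) +
      mixedNorm 6 (3 / 2) z₀ (3 * a / 2) (uncurry p) ≤ N₄ := by
    have e1 := (hf_le (R := 3 * a / 2) 6 (3 / 2) (by norm_num) (by norm_num) h14).trans hG₃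
    have e2 := hU (R := 3 * a / 2) 6 (3 / 2) (by norm_num) (by norm_num) h14
    rw [hN₄]
    gcongr
  obtain ⟨V, hVae, hVholder⟩ := hCC u f p G hSt₁ hGw₁ (hsum.trans_lt hN₄_lt)
  /- Step 7: restriction to `Q(a/2) = 𝒞(a/2) × ]-a²/4, 0[` -/
  have hhalf : parCyl 0 (a / 2) ⊆ parabolicCylinder a z₀ := parCyl_half_subset_parabolicCylinder ha
  refine ⟨V, ae_restrict_of_ae_restrict_of_subset hhalf hVae, ?_⟩
  refine holderOnWith_of_parabolic hμ0 (fun z₁ h₁ z₂ h₂ => dist_le_of_mem_parCyl_half ha h₁ h₂)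
    fun z₁ h₁ z₂ h₂ => ?_
  refine (hVholder z₁ (hhalf h₁) z₂ (hhalf h₂)).trans ?_
  rw [ENNReal.coe_toNNReal hK_ne]
  gcongr

end SereginSverak2009

end Literature.Analysis.FluidPDE
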